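import Mathlib
import HarnessLib
import Summits.CriticalPhenomena.SAWScalingLimit.Theses.SAWDefectDecoherence
import Summits.CriticalPhenomena.SAWScalingLimit.Theorems.SAWDefectDecoherenceTipMartingaleDefs
import Summits.CriticalPhenomena.SAWScalingLimit.Theorems.SAWDefectDecoherenceDefectDecoherenceMacroRecursion
import Literature.Probability.RandomPlanarGeometry.HexDomainSingleton
import Literature.Barriers.CriticalPhenomena.ParafermionicHalfCauchyRiemann

/-!
# Line `tip-martingale-depth-induction` — skeleton for crux `DefectDecoherence`
(stmt-CriticalPhenomena-8549, route `SAWDefectDecoherence`)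

The crux: `∃ C, θ > 3/4` with `‖T(Λ,a,v)‖ ≤ C R^{-θ} M(Λ,a,v)` for every simply connected
hexagonal domain `Λ`, adjacent boundary root `a = s(u,w)` (`u ∉ Λ ∋ w`) and `R`-deep vertex `v`,
where `T` is the conjugated vertex-star combination of the DCS observable at `(x_c, 5/8)` and `M`
the star mass at spin `0`.

THE LINE (idea card `Ideas/tip-martingale-depth-induction.md`, sharpened by TRIAGE-r1-{1,2,3}
and by this plan): the defect seen from the tip is an exact exploration martingale; optional
stopping at the FIRST ENTRANCE of the walk into the lattice ball `B(v,r)` writes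
`T(Λ,a,v) = Σ_π weight(π) · T(Λ∖π, a_π, v)` and `M(Λ,a,v) = Σ_π x_c^{|π|} M(Λ∖π, a_π, v)` over
first-entrance prefixes `π` (a class closed under slitting: `Λ∖π` is simply connected, `a_π` an
adjacent boundary root, `v` stays `r`-deep).  The continuation sum of a prefix is TELESCOPED over
picture scales `s₀ < 2s₀ < ⋯ < 2^J s₀ ≤ R`: the part carried by continuation walks that stay in
`B(v,s_i)` but leave `B(v,s_{i-1})` depends only on the PICTURE of `π` at scale `s_i` (its vertices
inside `B(v,s_i)` and its entrance dart), and is EXACTLY `ℤ/3`-covariant under rotating the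
picture by `120°` about `c_v` (`T ↦ ω̄ T`, `M ↦ M`).  Grouping prefixes by the `ℤ/3`-orbit of their
picture, the prefix phases `e^{-iσW(π)}` recombine with the character `e^{-13πiK/12}` of the
lifted entrance angle (`K = k + 3N`, `k` the rotation, `N` the sheet), and the level-`i` term is
contracted by the orbit-averaged coefficient `φ(R/s_i)` (stub `stub_orbitMixing`), while the walks
that leave `B(v,s_{i-1})` cost `(s_{i-1}/r)^{-β}` by strata of closest pre-exit approach (stub
`stub_wallExit`) and carry the induction hypothesis at the stratum's depth (second order).  The
resulting one-step recursion (stub `stub_telescopingRecursion`, exact identities + triangle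
inequalities) is closed by a Fekete-type induction over dyadic depth blocks (stub
`stub_scaleInduction`, pure real analysis): `θ_line = min(α, β)` — NOT the card's lossy
`αβ/(α+β)` — so the line needs only `α > 3/4` and `β > 3/4` (predicted `α = 19/16`, the
triage-consensus dipole–alias rate, and `β ∈ [1, 3/2]`, the wall/3-arm exit exponent).

Composition `DefectDecoherence_of : S1 → S2 → S3 → S4 → DefectDecoherence` is proved below
(with the crude bound `‖T‖ ≤ M/2` and monotonicity of `DepthBound`, both proved here).

Disproof honoured: `defectDecoherence_false_without_depth` — the `R`-ball hypothesis is used in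
`stub_telescopingRecursion` (`ball Λ v s = ` the full lattice ball needs `s ≤ R`) and in
`stub_wallExit` (depth `ρ ≥ 1`); the dictionary `defectDecoherence_iff_plainStar` /
`conj_star_sum_eq` is not needed (we work with the conjugated combination `T` itself, which is
covariant: `T(ρ·) = ω̄ T(·)`).

RESHAPE (lead, 2026-08-16, after wave 1 + drefute): S3 `stub_telescopingRecursion` and S4
`stub_scaleInduction` LANDED in their registered forms (Theorems/…TelescopingRecursion.lean p86252 with 7
helper files; Theorems/…ScaleInduction.lean p74879).  The parallel drefuter graded S1 `stub_orbitMixing`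
MIS-STATED (over-strong: at `(r,s) = (1,2)` `MixingBound` alone is the crux for the in-ball-truncated
defect), with the corrected macroscopic form S1' = `OrbitMixingMacro` (ratio cap `m₀`, scale floor
`smin(m₀)`), and showed that the composition only ever consumes ratios `≤ 2^J` and scales `≥ smin`.
The skeleton below is that reshaped line: stubs S1' `stub_orbitMixingMacro`, S2 `stub_wallExit`
(unchanged), S3' `stub_telescopingRecursionMacro`, S4' `stub_scaleInductionMacro`; the composition
`DefectDecoherence_of` is re-proved over them; S3'/S4' are the landed S3/S4 proofs re-run with the
restricted hypotheses and have LANDED too (Theorems/…MacroRecursion.lean, p87402): the two remaining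
sorries are the open exponent inputs S1', S2.
-/

namespace Summit.CriticalPhenomena.SAWScalingLimit.Cruxes.DefectDecoherence.TipMartingaleDepthInduction

open scoped BigOperators ComplexConjugate Classical
open Literature.Probability.LatticeModels Literature.Probability.RandomPlanarGeometry.SAW
open Summit.CriticalPhenomena.SAWScalingLimit.Theorems.DefectDecoherence.TipMartingale

noncomputable section

/-! ### Vocabulary

All objects (`xc`, `star`, `defect`, `mass`, `ball`, `Deep`, `Admissible`, `DepthBound`, `CrudeBound`,
`IsPrefix`, `Picture`, `pic`, `picDom`, `rot3`, `rotPic`, `prefixSumC/R`, `picAmp`, `picMass`,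
`contraction`, `MixingBound`, `exitMass`, `ExitBound`, `strataSum`, `etaNew`, `RecursionStep`) are the
LANDED vocabulary file `Theorems/SAWDefectDecoherenceTipMartingaleDefs.lean` (namespace
`…Theorems.DefectDecoherence.TipMartingale`, opened above), so that stub files and this file share them. -/

/-! ### Vocabulary of the reshape

`MixingBoundOn`, `RecursionStepOn` (and the comparison lemmas `MixingBound.on`,
`RecursionStep.on`) are the LANDED file `Theorems/…MacroRecursion.lean` (p87402), which also proves
S3' and S4'. -/

/-! ### The four statements of the reshaped line, as named propositions -/

/-- **S1' — macroscopic one-scale orbit mixing at a rate `α > 3/4`**: a constant `cα` uniform in the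
ratio cap `m₀`, each bounded-ratio instance required only for picture scales `s ≥ smin(m₀)`. -/
def OrbitMixingMacro : Prop :=
  ∃ cα α : ℝ, 3 / 4 < α ∧ 0 ≤ cα ∧
    ∀ m₀ : ℝ, 1 ≤ m₀ → ∃ smin : ℝ, MixingBoundOn (fun m => cα * m ^ (-α)) m₀ smin

/-- **S2 — wall–exit bound at an exponent `β > 3/4`** (unchanged). -/
def WallExit : Prop :=
  ∃ c β : ℝ, 3 / 4 < β ∧ 0 ≤ c ∧ ExitBound c β

/-- **S3' — the telescoped recursion from macroscopic mixing.** -/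
def TelescopingRecursionMacro : Prop :=
  ∀ (φ : ℝ → ℝ) (c β B₀ : ℝ), (∀ m, 1 ≤ m → 0 ≤ φ m) → 0 ≤ c → 0 < β → 0 ≤ B₀ →
    CrudeBound B₀ → (∀ m₀ : ℝ, 1 ≤ m₀ → ∃ smin : ℝ, MixingBoundOn φ m₀ smin) → ExitBound c β →
      ∀ J : ℕ, ∃ smin : ℝ, RecursionStepOn DepthBound φ c β B₀ J smin

/-- **S4' — Fekete-type induction started at a high dyadic block.** -/
def ScaleInductionMacro : Prop :=
  ∀ (D : ℝ → ℝ → Prop) (cα α c β B₀ : ℝ),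
    (∀ R b b', b ≤ b' → D R b → D R b') → 3 / 4 < α → 3 / 4 < β → 0 ≤ cα → 0 ≤ c → 0 ≤ B₀ →
    (∀ ρ, 1 ≤ ρ → D ρ B₀) →
    (∀ J : ℕ, ∃ smin : ℝ, RecursionStepOn D (fun m => cα * m ^ (-α)) c β B₀ J smin) →
    ∃ C θ : ℝ, 3 / 4 < θ ∧ ∀ R, 1 ≤ R → D R (C * R ^ (-θ))

/-! ### The stubs (registered; signatures spelled out, definitionally the named statements) -/

/-- **S1' (HARDEST, open)** — macroscopic orbit mixing: the orbit-averaged contraction of the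
`13/8`-character of the lifted entrance law, given the exact picture, is `≤ cα (R/s)^{-α}` for
ratios `R/s ≤ m₀` once `s ≥ smin(m₀)`, some `α > 3/4`, `cα` uniform in `m₀`.  Prediction `α = 19/16`.
All the decay must come from winding (sheet) decoherence of the critical walk between the scales
`R` and `s` (the bare `ℤ/3` average has modulus `|1 + e^{-13πi/12} + e^{-26πi/12}|/3 ≈ 0.31`). -/
theorem stub_orbitMixingMacro :
    ∃ cα α : ℝ, 3 / 4 < α ∧ 0 ≤ cα ∧
      ∀ m₀ : ℝ, 1 ≤ m₀ → ∃ smin : ℝ, MixingBoundOn (fun m => cα * m ^ (-α)) m₀ smin := by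
  sorry

/-- **S2 (open)** — wall–exit bound at an exponent `β > 3/4` (prediction `β = 1`, straight slit
worst).  Implies finiteness of the critical two-point function of the slit plane (drefute,
`Theorems/DefectDecoherence/Negative/WallExitTwoPoint.lean`), known only conditionally. -/
theorem stub_wallExit :
    ∃ c β : ℝ, 3 / 4 < β ∧ 0 ≤ c ∧ ExitBound c β := by
  sorry

/-- **S3'** — the telescoped first-entrance recursion from macroscopic mixing (the landed S3 proof
re-run at `R = s₀2^J`: mixing is used at ratios `2^{J-i} ≤ 2^J` and scales `s₀2^i ≥ s₀ ≥ smin(2^J)`). -/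
theorem stub_telescopingRecursionMacro :
    ∀ (φ : ℝ → ℝ) (c β B₀ : ℝ), (∀ m, 1 ≤ m → 0 ≤ φ m) → 0 ≤ c → 0 < β → 0 ≤ B₀ →
      CrudeBound B₀ → (∀ m₀ : ℝ, 1 ≤ m₀ → ∃ smin : ℝ, MixingBoundOn φ m₀ smin) → ExitBound c β →
        ∀ J : ℕ, ∃ smin : ℝ, RecursionStepOn DepthBound φ c β B₀ J smin :=
  -- LANDED (p87402, Theorems/…MacroRecursion.lean)
  Summit.CriticalPhenomena.SAWScalingLimit.Theorems.DefectDecoherence.TipMartingale.stub_telescopingRecursionMacro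

/-- **S4'** — Fekete-type induction over dyadic depth blocks, started at a block high enough that
only scales `s₀ ≥ smin(J)` occur (the landed S4 proof with a larger base constant). -/
theorem stub_scaleInductionMacro :
    ∀ (D : ℝ → ℝ → Prop) (cα α c β B₀ : ℝ),
      (∀ R b b', b ≤ b' → D R b → D R b') → 3 / 4 < α → 3 / 4 < β → 0 ≤ cα → 0 ≤ c → 0 ≤ B₀ →
      (∀ ρ, 1 ≤ ρ → D ρ B₀) →
      (∀ J : ℕ, ∃ smin : ℝ, RecursionStepOn D (fun m => cα * m ^ (-α)) c β B₀ J smin) →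
      ∃ C θ : ℝ, 3 / 4 < θ ∧ ∀ R, 1 ≤ R → D R (C * R ^ (-θ)) :=
  -- LANDED (p87402, Theorems/…MacroRecursion.lean)
  Summit.CriticalPhenomena.SAWScalingLimit.Theorems.DefectDecoherence.TipMartingale.stub_scaleInductionMacro

/-! ### Consistency: each named statement IS its registered stub (definitionally) -/

theorem orbitMixingMacro_holds : OrbitMixingMacro := stub_orbitMixingMacro
theorem wallExit_holds : WallExit := stub_wallExit
theorem telescopingRecursionMacro_holds : TelescopingRecursionMacro := stub_telescopingRecursionMacro
theorem scaleInductionMacro_holds : ScaleInductionMacro := stub_scaleInductionMacro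

/-! ### Name-keyed aliases of the four statements (the hypotheses of the composition) -/
namespace Registered

/-- Alias of `OrbitMixingMacro` keyed by the registered stub name. -/
abbrev stub_orbitMixingMacro : Prop := OrbitMixingMacro
/-- Alias of `WallExit` keyed by the registered stub name. -/
abbrev stub_wallExit : Prop := WallExit
/-- Alias of `TelescopingRecursionMacro` keyed by the registered stub name. -/
abbrev stub_telescopingRecursionMacro : Prop := TelescopingRecursionMacro
/-- Alias of `ScaleInductionMacro` keyed by the registered stub name. -/
abbrev stub_scaleInductionMacro : Prop := ScaleInductionMacro

end Registered

/-! ### Proved glue -/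

/-- Adjacent honeycomb vertices have centres at squared distance `1/3`. -/
theorem normSq_hexCenter_sub_of_adj {v t : HexVertex} (h : hexGraph.Adj v t) :
    Complex.normSq (hexCenter t - hexCenter v) = 1 / 3 := by
  obtain ⟨x, i⟩ := t
  obtain ⟨y, j⟩ := v
  rw [hexCenter_sub_hexCenter, normSq_add_mul_triZeta]
  fin_cases i <;> fin_cases j
  · exact absurd h (Literature.Barriers.CriticalPhenomena.HexKernel.not_hexGraph_adj_of_snd_eq_holds _ _ rfl)
  · rcases (Literature.Barriers.CriticalPhenomena.HexKernel.hexGraph_adj_iff_of_snd_eq_zero_holds x y).1 h.symm with rfl | rfl | rfl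
    · simp; norm_num
    · simp [Pi.sub_apply]; norm_num
    · simp [Pi.sub_apply]; norm_num
  · rcases (Literature.Barriers.CriticalPhenomena.HexKernel.hexGraph_adj_iff_of_snd_eq_zero_holds y x).1 h with rfl | rfl | rfl
    · simp; norm_num
    · simp [Pi.sub_apply]; norm_num
    · simp [Pi.sub_apply]; norm_num
  · exact absurd h (Literature.Barriers.CriticalPhenomena.HexKernel.not_hexGraph_adj_of_snd_eq_holds _ _ rfl)

/-- `‖mid{v,t} - c_v‖ ≤ 1/2` for `t ∼ v` (it equals `1/(2√3)`). -/
theorem norm_hexMidpoint_sub_hexCenter_le {v t : HexVertex} (h : hexGraph.Adj v t) :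
    ‖hexMidpoint s(v, t) - hexCenter v‖ ≤ 1 / 2 := by
  have hmid : hexMidpoint s(v, t) - hexCenter v = (hexCenter t - hexCenter v) / 2 := by
    rw [hexMidpoint_mk]; ring
  have hle : ‖hexCenter t - hexCenter v‖ ≤ 1 := by
    rw [← sq_le_one_iff₀ (norm_nonneg _), Complex.sq_norm, normSq_hexCenter_sub_of_adj h]
    norm_num
  rw [hmid, norm_div, Complex.norm_two]
  linarith

/-- The crude bound `‖T(Λ,a,v)‖ ≤ M(Λ,a,v)/2` (triangle inequality, unimodular winding weights). -/
theorem crude_bound : CrudeBound (1 / 2) := by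
  intro Λ u w v
  unfold defect mass
  rw [Finset.mul_sum]
  refine (norm_sum_le _ _).trans (Finset.sum_le_sum fun t ht => ?_)
  have hadj : hexGraph.Adj v t := (Finset.mem_filter.1 ht).2
  have hxc : 0 ≤ xc := hexCriticalFugacity_pos_lt_one.1.le
  have h1 : ‖(starRingEnd ℂ) (hexMidpoint s(v, t) - hexCenter v)‖ ≤ 1 / 2 := by
    rw [RCLike.norm_conj]
    exact norm_hexMidpoint_sub_hexCenter_le hadj
  have h2 : ‖hexParafermionicObservable Λ s(u, w) xc (5 / 8) s(v, t)‖ ≤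
      ‖hexParafermionicObservable Λ s(u, w) xc 0 s(v, t)‖ := by
    rw [hexParafermionicObservable_zero_spin, Complex.norm_real,
      Real.norm_of_nonneg (Finset.sum_nonneg fun γ _ => pow_nonneg hxc _)]
    exact norm_hexParafermionicObservable_le _ _ hxc _ _
  rw [norm_mul]
  calc ‖(starRingEnd ℂ) (hexMidpoint s(v, t) - hexCenter v)‖ *
        ‖hexParafermionicObservable Λ s(u, w) xc (5 / 8) s(v, t)‖
      ≤ (1 / 2) * ‖hexParafermionicObservable Λ s(u, w) xc (5 / 8) s(v, t)‖ :=
        mul_le_mul_of_nonneg_right h1 (norm_nonneg _)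
    _ ≤ (1 / 2) * ‖hexParafermionicObservable Λ s(u, w) xc 0 s(v, t)‖ :=
        mul_le_mul_of_nonneg_left h2 (by norm_num)

/-! ### Composition: the four stubs imply the crux BY NAME -/

/-- **The reshaped line concludes the crux.** -/
theorem DefectDecoherence_of (h1 : Registered.stub_orbitMixingMacro) (h2 : Registered.stub_wallExit)
    (h3 : Registered.stub_telescopingRecursionMacro) (h4 : Registered.stub_scaleInductionMacro) :
    Summit.CriticalPhenomena.SAWScalingLimit.Theses.SAWDefectDecoherence.DefectDecoherence := by
  obtain ⟨cα, α, hα, hcα, hmix⟩ := h1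
  obtain ⟨c, β, hβ, hc, hexit⟩ := h2
  have hrec : TelescopingRecursionMacro := h3
  have hind : ScaleInductionMacro := h4
  have hB : CrudeBound (1 / 2) := crude_bound
  have hφ : ∀ m : ℝ, 1 ≤ m → 0 ≤ cα * m ^ (-α) := fun m hm =>
    mul_nonneg hcα (Real.rpow_nonneg (by linarith) _)
  have hstep : ∀ J : ℕ, ∃ smin : ℝ,
      RecursionStepOn DepthBound (fun m => cα * m ^ (-α)) c β (1 / 2) J smin :=
    hrec (fun m => cα * m ^ (-α)) c β (1 / 2) hφ hc (by linarith) (by norm_num) hB hmix hexit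
  have hbase : ∀ ρ : ℝ, 1 ≤ ρ → DepthBound ρ (1 / 2) := fun ρ _ Λ u w v _ => hB Λ u w v
  obtain ⟨C, θ, hθ, hD⟩ :=
    hind DepthBound cα α c β (1 / 2) depthBound_mono hα hβ hcα hc (by norm_num) hbase hstep
  refine ⟨C, θ, hθ, ?_⟩
  intro Λ hsc u w hadj hu hw v R hR hdeep
  exact hD R hR Λ u w v ⟨hsc, hadj, hu, hw, hR, hdeep⟩

/-- Wiring check: the registered stubs feed `DefectDecoherence_of` as stated. -/
example : Summit.CriticalPhenomena.SAWScalingLimit.Theses.SAWDefectDecoherence.DefectDecoherence :=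
  DefectDecoherence_of stub_orbitMixingMacro stub_wallExit stub_telescopingRecursionMacro
    stub_scaleInductionMacro

end

end Summit.CriticalPhenomena.SAWScalingLimit.Cruxes.DefectDecoherence.TipMartingaleDepthInduction
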